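import Literature.NumberTheory.EllipticCurves.WeilPairingTateDual
import Literature.NumberTheory.EllipticCurves.KummerSelmerStructure
import Literature.NumberTheory.EllipticCurves.OrdinaryLocalCondition
import HarnessLib

/-!
# Route `KolyvaginRoadThree`, deciding crux `ZhangSharpFrameAtThreeHL` (item stmt-BirchSwinnertonDyer-19574):
# ORDINARY classes at a level prime — an invariant-valued representative of the localisation, and the
# isotropy of the ordinary line `e(L₀, L₀) = 0` (koly MEMO-v8 §2(d)) for the local Weil cup product
# (cell `bsd-stepL`, seat `bsd-stepL-koly` g13; `--supports stmt-BirchSwinnertonDyer-19574`, helper)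

WHY THIS FILE. Sibling of `…Method2IsoLocalDuality.lean` (see its docstring): the Poitou–Tate see-saw for the
`q`-relaxed level-`n` space `SelRelQ (insert q n) {q}` of the METHOD skeleton needs the local Weil terms of two of its
classes to vanish at every place `w ≠ v_q`. At the places outside the level this is the (discharged) Kummer isotropy;
at the place `w` of a level prime `q' ∈ n` both classes satisfy the ORDINARY condition
`WeierstrassCurve.ordinaryLocalKer` (Literature `OrdinaryLocalCondition.lean`, koly g11: the localisation is
represented by a cocycle valued in the `Γ_w`-FIXED points `L₀ = E(K̄_w)[n]^{Γ_w}`), and the vanishing is the elementary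
`e(L₀, L₀) = 0`: when `#L₀ ≤ p` (prime level `p`; `h⁰ = 1` at a good unipotent-admissible prime) `L₀` is cyclic and the
Weil pairing is alternating. This file proves exactly that, for an elliptic curve `E = W` over a number field `K`,
`n ≥ 1`, and an arbitrary `K`-field `E` (a completion):
* `exists_invariant_cocycle_of_mem_ordinaryLocalKer` — for `x ∈ ordinaryLocalKer W E n`, the restriction
  `res_E x ∈ H¹(Γ_E, E[n](K̄)|_{Γ_E})` is the class of a cocycle with values in the `Γ_E`-invariants (transport of
  the fixed-point-valued representative along the torsion comparison `θ = torsionPointsEquiv`, `θ⁻¹ ∘ ψ'`);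
* `weilCupProduct_res_eq_zero_of_mem_ordinaryLocalKer` — if the additive Weil pairing vanishes on invariants ×
  invariants, the local Weil cup product of two ordinary classes is `0` (its homogeneous `2`-cochain
  `(a,b,c) ↦ e(ψ b − ψ a, χ c − χ b)` vanishes identically);
* `weilPairingHom_eq_zero_of_invariant_of_card_le` — for prime `n = p` and `#(E[p]|_{Γ_E})^{Γ_E} ≤ p` the
  invariants form a cyclic group of order `1` or `p`, on which an alternating pairing vanishes.

HONEST FRAMING: theorems only (cocycle bookkeeping + `e(aP, bP) = e(P,P)^{ab} = 1`); no definition, no named fact,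
no `sorry`; closes nothing (T7). PARTITION: O2@3 (B10) × A1 × crux 19574 — types-the-object-of; closes: none.

References: [cite: BertoliniDarmon2005, §2.2–§2.3 (H¹_ord)] [cite: WZhang2014, §4.1, Prop. 5.4]
[cite: SilvermanAEC2009, Prop. III.8.1 (the Weil pairing is alternating)].
-/

noncomputable section

open scoped Classical

universe u

namespace Summit.BirchSwinnertonDyer.Rank1Residual.X11b.Three.Koly.Method2.Iso

open CategoryTheory WeierstrassCurve Field Function NumberField IsDedekindDomain
open Literature.NumberTheory.EllipticCurves Literature.NumberTheory.GaloisRepresentations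
open Literature.NumberTheory.GaloisRepresentations.DiscreteGaloisModule (mu MuCarrier)
open scoped ContRepresentation

-- Cup products need `LocallyCompactSpace Γ`; as in the tree's cup-product files, the compactness of
-- absolute Galois groups is a local instance only; `E[n]` finite for the Tate-dual bookkeeping.
attribute [local instance] absoluteGaloisGroup_compactSpace
attribute [local instance] finite_geomTorsion_of_neZero

/-! ## Ordinary classes: an invariant-valued representative of the restriction, and isotropy -/

section Ordinary

variable {K : Type u} [Field K] [NumberField K] (W : WeierstrassCurve K) (n : ℕ) [NeZero n]
  [W.IsElliptic]
variable (E : Type u) [Field E] [Algebra K E]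

/-- **An ordinary class restricts to the class of an INVARIANT-valued cocycle.** For `x ∈ H¹(K, E[n])` in the
ordinary local condition at the `K`-field `E` (`WeierstrassCurve.ordinaryLocalKer`: `torsionLocMap x` is represented
by a cocycle `ψ'` of `Γ_E` valued in the fixed points `E(K̄_E)[n]^{Γ_E}`), the restriction `res_E x` to the
restricted module `E[n](K̄)|_{Γ_E}` is the class of a cocycle `ψ` all of whose values are `Γ_E`-invariant — namely
`ψ = θ⁻¹ ∘ ψ'` for the torsion comparison `θ : E[n](K̄) ≃ E(K̄_E)[n]` (`torsionPointsEquiv`, equivariant), the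
difference with `φ ∘ res` being the coboundary of `θ⁻¹ m`. Bertolini–Darmon's `H¹_ord = im H¹(K_q, F⁺)` read on
representatives; Serre, *Galois Cohomology*, I.§2.4 ∕ I.§5.1. [cite: BertoliniDarmon2005, §2.2 (H¹_ord)] -/
theorem exists_invariant_cocycle_of_mem_ordinaryLocalKer
    {x : galH1Torsion W (n : ℤ)} (hx : x ∈ W.ordinaryLocalKer E (n : ℤ)) :
    ∃ ψ : contOneCocycles
        (DiscreteGaloisModule.toTopRep (GaloisRep.restrictField E (W.torsionGaloisModule n))),
      (∀ σ τ : absoluteGaloisGroup E, absGaloisRestrict K E τ • ψ.1 σ = ψ.1 σ) ∧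
      oneCocycleClass _ ψ = galoisCohomology.res (W.torsionGaloisModule n) E 1 x := by
  have hn : (n : ℤ) ≠ 0 := by exact_mod_cast NeZero.ne n
  obtain ⟨φ, rfl⟩ :=
    oneCocycleClass_surjective (discreteTopRep (absoluteGaloisGroup K) (geomTorsion W n)) x
  -- unfold the ordinary condition: `loc_E [φ] = [ψ']` with `ψ'` fixed-point-valued
  change oneCocycleClass _ φ ∈ AddSubgroup.comap _ _ at hx
  rw [AddSubgroup.mem_comap] at hx
  obtain ⟨ψ', hψ'L, hψ'⟩ := hx
  -- `loc_E [φ] = [σ ↦ θ (φ (res σ))]`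
  have hloc : W.torsionLocMap E (n : ℤ)
        (oneCocycleClass (discreteTopRep (absoluteGaloisGroup K) (geomTorsion W n)) φ) =
      oneCocycleClass (discreteTopRep (absoluteGaloisGroup E)
          (AddSubgroup.torsionBy (localPoints W E) (n : ℤ)))
        (contOneCocycles.pullback (resGal (K := K) E)
          (resHomOfEquivariant (resGal (K := K) E)
            (torsionPointsMap W E n) (torsionPointsMap_smul W E n)) φ) :=
    map_oneCocycleClass _ _ _ φ
  rw [hloc, ← sub_eq_zero, ← oneCocycleClass_sub, oneCocycleClass_eq_zero_iff] at hψ'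
  obtain ⟨m, hm⟩ := hψ'
  -- `hm σ : ψ' σ - θ (φ (res σ)) = σ • m - m`
  have hm' : ∀ σ : absoluteGaloisGroup E,
      ψ'.1 σ - torsionPointsMap W E n (φ.1 (resGal (K := K) E σ)) = σ • m - m := fun σ => hm σ
  set θ := W.torsionPointsEquiv (n : ℤ) (E := E) hn with hθ
  -- the cocycle `ψ = θ⁻¹ ∘ ψ'` of the restricted module
  have hcoc : ∀ g h : absoluteGaloisGroup E, ψ'.1 (g * h) = ψ'.1 g + g • ψ'.1 h := fun g h => ψ'.2 g h
  let ψ : contOneCocycles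
      (DiscreteGaloisModule.toTopRep (GaloisRep.restrictField E (W.torsionGaloisModule n))) :=
    ⟨⟨fun σ => θ.symm (ψ'.1 σ), continuous_of_discreteTopology.comp ψ'.1.continuous⟩, fun g h => by
      change θ.symm (ψ'.1 (g * h)) = θ.symm (ψ'.1 g) + absGaloisRestrict K E g • θ.symm (ψ'.1 h)
      rw [← resGal_eq_absGaloisRestrict, ← torsionPointsEquiv_symm_smul, ← map_add, hcoc g h]⟩
  have hψ : ∀ σ, ψ.1 σ = θ.symm (ψ'.1 σ) := fun σ => rfl
  refine ⟨ψ, fun σ τ => ?_, ?_⟩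
  · -- invariance: `ψ' σ` is a fixed point
    rw [hψ, ← resGal_eq_absGaloisRestrict, ← torsionPointsEquiv_symm_smul]
    congr 1
    exact hψ'L σ τ
  · -- the class: `ψ - φ_E` is the coboundary of `θ⁻¹ m`
    rw [res_torsionGaloisModule_oneCocycleClass, ← sub_eq_zero, ← oneCocycleClass_sub,
      oneCocycleClass_eq_zero_iff]
    refine ⟨θ.symm m, fun g => ?_⟩
    change θ.symm (ψ'.1 g) - φ.1 (absGaloisRestrict K E g) =
      absGaloisRestrict K E g • θ.symm m - θ.symm m
    rw [← resGal_eq_absGaloisRestrict, ← torsionPointsEquiv_symm_smul, ← map_sub, ← hm', map_sub]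
    congr 1
    apply θ.injective
    rw [AddEquiv.apply_symm_apply, torsionPointsEquiv_apply]

variable (e : geomTorsion W n → geomTorsion W n → AlgebraicClosure K)
  (hμ : ∀ S T, e S T ^ n = 1)
  (hadd₁ : ∀ S₁ S₂ T, e (S₁ + S₂) T = e S₁ T * e S₂ T)
  (hadd₂ : ∀ S T₁ T₂, e S (T₁ + T₂) = e S T₁ * e S T₂)
  (hgal : ∀ (σ : absoluteGaloisGroup K) (S T : geomTorsion W n), σ • e S T = e (σ • S) (σ • T))

/-- **Two ORDINARY classes have vanishing local Weil cup product when `e(L₀, L₀) = 0`.** If the additive Weil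
pairing `weilPairingHom` vanishes on (`Γ_E`-invariant) × (`Γ_E`-invariant) points of `E[n](K̄)|_{Γ_E}`, then for
`y, z ∈ ordinaryLocalKer W E n` the cup product of `res_E y` and `res_E z` for the restriction of `weilContPairing` to
`Γ_E` (at a place: `weilContPairingLocal`) is `0`: on invariant-valued representatives `ψ, χ`
(`exists_invariant_cocycle_of_mem_ordinaryLocalKer`) the homogeneous `2`-cochain `(a,b,c) ↦ e(ψ b − ψ a, χ c − χ b)`
(`ContPairing.cupTwoCochain`) is identically zero. This is the isotropy of the ordinary line `H¹_ord` at a level prime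
(koly MEMO-v8 §2(d): `e(L₀, L₀) = 0`), the local input of the see-saw at the places of the level.
[cite: WZhang2014, §4.1, Prop. 5.4] [cite: BertoliniDarmon2005, §2.3] -/
theorem weilCupProduct_res_eq_zero_of_mem_ordinaryLocalKer
    (hinv : ∀ S T : geomTorsion W n, (∀ τ : absoluteGaloisGroup E, absGaloisRestrict K E τ • S = S) →
      (∀ τ : absoluteGaloisGroup E, absGaloisRestrict K E τ • T = T) →
        weilPairingHom W n e hμ hadd₁ hadd₂ S T = 0)
    {y z : galH1Torsion W (n : ℤ)} (hy : y ∈ W.ordinaryLocalKer E (n : ℤ))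
    (hz : z ∈ W.ordinaryLocalKer E (n : ℤ)) :
    ((weilContPairing W n e hμ hadd₁ hadd₂ hgal).restrict (absGaloisRestrict K E)).cupProduct
      (galoisCohomology.res (W.torsionGaloisModule n) E 1 y)
      (galoisCohomology.res (W.torsionGaloisModule n) E 1 z) = 0 := by
  obtain ⟨ψy, hψy, hy'⟩ := exists_invariant_cocycle_of_mem_ordinaryLocalKer W n E hy
  obtain ⟨ψz, hψz, hz'⟩ := exists_invariant_cocycle_of_mem_ordinaryLocalKer W n E hz
  rw [← hy', ← hz']
  erw [ContPairing.cupProduct_oneCocycleClass]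
  -- the cup-product cochain vanishes identically: `e(L₀, L₀) = 1` on the invariant line
  have hcoch : ((weilContPairing W n e hμ hadd₁ hadd₂ hgal).restrict (absGaloisRestrict K E)).cupTwoCochain
        ψy ψz =
      ((weilContPairing W n e hμ hadd₁ hadd₂ hgal).restrict (absGaloisRestrict K E)).cupTwoCochain
        0 ψz := by
    apply Subtype.ext
    refine ContinuousMap.ext fun a => ContinuousMap.ext fun b => ContinuousMap.ext fun c => ?_
    rw [ContPairing.cupTwoCochain_apply, ContPairing.cupTwoCochain_apply]
    change weilPairingHom W n e hμ hadd₁ hadd₂ (ψy.1 b - ψy.1 a) (ψz.1 c - ψz.1 b) =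
      weilPairingHom W n e hμ hadd₁ hadd₂ ((0 : contOneCocycles _).1 b - (0 : contOneCocycles _).1 a)
        (ψz.1 c - ψz.1 b)
    have h0 : ∀ g : absoluteGaloisGroup E, (0 : contOneCocycles (TopRep.res
        (absGaloisRestrict K E : absoluteGaloisGroup E →* absoluteGaloisGroup K)
        (W.torsionGaloisModule n).toTopRep)).1 g = 0 := fun g => rfl
    rw [h0, h0, sub_zero, map_zero, AddMonoidHom.zero_apply,
      hinv _ _ (fun τ => by rw [smul_sub, hψy, hψy]) (fun τ => by rw [smul_sub, hψz, hψz])]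
  unfold ContPairing.cupClass
  rw [cxClass_congr hcoch]
  exact ContPairing.cupClass_eq_zero_of_left _ 0 ψz (oneCocycleClass_zero _)

omit [NumberField K] in
/-- **`e(L₀, L₀) = 0` when `#L₀ ≤ p`.** For a prime level `n = p`, an alternating `e` and
`#(E[p](K̄)|_{Γ_E})^{Γ_E} ≤ p`: the additive Weil pairing vanishes on any two `Γ_E`-invariant points `S, T` — a
non-zero invariant `S` has order `p`, so `ℤ·S` is ALL of the invariants (counting) and `T = b•S`,
`e(S, b•S) = b • e(S,S) = 0`. (At a good unipotent-admissible prime `h⁰ = 1`: the toric line.)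
[cite: SilvermanAEC2009, Prop. III.8.1] [cite: BertoliniDarmon2005, §2.2] -/
theorem weilPairingHom_eq_zero_of_invariant_of_card_le [Fact n.Prime] (halt : ∀ T, e T T = 1)
    (hH : Nat.card (GaloisRep.restrictField E (W.torsionGaloisModule n)).toTopRep.ρ.invariants ≤ n)
    (S T : geomTorsion W n) (hS : ∀ τ : absoluteGaloisGroup E, absGaloisRestrict K E τ • S = S)
    (hT : ∀ τ : absoluteGaloisGroup E, absGaloisRestrict K E τ • T = T) :
    weilPairingHom W n e hμ hadd₁ hadd₂ S T = 0 := by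
  set H := (GaloisRep.restrictField E (W.torsionGaloisModule n)).toTopRep.ρ.invariants with hHdef
  have hSH : S ∈ H := (ContRepresentation.mem_invariants _).mpr fun τ => hS τ
  have hTH : T ∈ H := (ContRepresentation.mem_invariants _).mpr fun τ => hT τ
  by_cases hS0 : S = 0
  · rw [hS0, map_zero, AddMonoidHom.zero_apply]
  -- `S` has order `p` and generates `H`
  have hp : n.Prime := Fact.out
  have hord : addOrderOf S = n := addOrderOf_eq_prime (AddSubgroup.torsionBy.nsmul S) hS0
  haveI : Finite H := inferInstance
  have hle : AddSubgroup.zmultiples S ≤ H.toAddSubgroup := AddSubgroup.zmultiples_le_of_mem hSH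
  have hcard : Nat.card H.toAddSubgroup ≤ Nat.card (AddSubgroup.zmultiples S) := by
    rw [Nat.card_zmultiples, hord]
    exact hH
  have heq : AddSubgroup.zmultiples S = H.toAddSubgroup := AddSubgroup.eq_of_le_of_card_ge hle hcard
  have hTS : T ∈ AddSubgroup.zmultiples S := by rw [heq]; exact hTH
  obtain ⟨b, rfl⟩ := AddSubgroup.mem_zmultiples_iff.mp hTS
  rw [map_zsmul, weilPairingHom_self W n e hμ hadd₁ hadd₂ halt, smul_zero]

end Ordinary

end Summit.BirchSwinnertonDyer.Rank1Residual.X11b.Three.Koly.Method2.Iso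

end
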